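import Summits.QuantumAdvantage.QuantumAdvantage.Theses.TwoSquaresLadder

/-!
# Route `TwoSquaresLadder`, support `TwoSquaresFloor` (stmt-QuantumAdvantage-16062), part 1: divisor sums
# (the Landau floor, elementary second-moment form — part 2 `TwoSquaresLadderTwoSquaresFloor.lean` has the theorem)

`#(S₂ ∩ [2^{n−1}, 2ⁿ)) ≥ c · 2ⁿ / n³` eventually, where `S₂ = {u² + v²}`. Proof (no `L`-functions; Landau 1908 gives the
truth `~ K x/√(log x)`, far stronger):

* LATTICE POINTS: the box `u ∈ [⌊√(X/2)⌋ + 1, ⌊√(3X/4)⌋)`, `v ∈ [0, ⌊√(X/4)⌋)` (`X = 2ⁿ`) maps into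
  `S₂ ∩ [X/2, X)` by `(u, v) ↦ u² + v²` and has `≥ X/32` points for `n` large;
* CAUCHY–SCHWARZ: `#box² ≤ #(S₂ ∩ [X/2, X)) · #{collisions}`, collisions = pairs of box points with the same
  `u² + v²`;
* COLLISIONS `≤ #box + 2 Σ_{m ≤ X} τ(m)²`: a collision with `u > u'` gives `(u−u')(u+u') = (v'−v)(v'+v) = m` and
  each factor pair is determined by a divisor of `m` (`#{(a,c) : a > c, a² − c² = m} ≤ τ(m)`);
* DIVISORS: `Σ_{m ≤ X} τ(m)² = Σ_{d,e ≤ X} ⌊X/lcm(d,e)⌋ ≤ X · Σ_{d,e} gcd(d,e)/(de) ≤ X · H_X³`, `H_X = Σ_{k≤X} 1/k ≤ 1 + log X`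
  (inject `(d,e) ↦ (gcd, d/gcd, e/gcd)`).
Hence `#(S₂ ∩ [X/2,X)) ≥ (X/32)² / (3 X H_X³) ≥ 2ⁿ/(3072 n³)`.

HONEST FRAMING: a closed ledger item (an elementary counting lemma, kernel-checked), NOT summit progress.

References: E. Landau, Arch. Math. Phys. 13 (1908) 305–312 [Landau1918]; H. L. Montgomery, R. C. Vaughan,
*Multiplicative Number Theory I* (2007), §2.3 and §7.4 [MontgomeryVaughan2007].
-/

set_option linter.dupNamespace false -- D-0017: single-problem summit ⇒ `QuantumAdvantage.QuantumAdvantage` by design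

namespace Summit.QuantumAdvantage.QuantumAdvantage.Theorems.TwoSquaresFloor

open Finset

/-! ### Divisors: `Σ_{m ≤ X} τ(m)² ≤ X · H_X³` -/

/-- `τ(m)² = Σ_{(d,e) ≤ X} [d ∣ m ∧ e ∣ m]` for `1 ≤ m ≤ X`. [folklore] -/
theorem tau_sq_eq_sum (X m : ℕ) (hm : m ∈ Icc 1 X) :
    ((m.divisors.card ^ 2 : ℕ) : ℝ) =
      ∑ p ∈ Icc 1 X ×ˢ Icc 1 X, if p.1 ∣ m ∧ p.2 ∣ m then (1 : ℝ) else 0 := by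
  rw [Finset.mem_Icc] at hm
  rw [Finset.sum_boole, sq, ← Finset.card_product]
  congr 2
  ext ⟨d, e⟩
  simp only [Finset.mem_product, Nat.mem_divisors, Finset.mem_filter, Finset.mem_Icc]
  constructor
  · rintro ⟨⟨hd, hm0⟩, ⟨he, _⟩⟩
    have hd1 := Nat.pos_of_dvd_of_pos hd (by omega)
    have he1 := Nat.pos_of_dvd_of_pos he (by omega)
    have hdm := Nat.le_of_dvd (by omega) hd
    have hem := Nat.le_of_dvd (by omega) he
    exact ⟨⟨⟨hd1, by omega⟩, ⟨he1, by omega⟩⟩, hd, he⟩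
  · rintro ⟨_, hd, he⟩
    exact ⟨⟨hd, by omega⟩, ⟨he, by omega⟩⟩

/-- `#{m ≤ X : d ∣ m ∧ e ∣ m} = ⌊X / lcm(d,e)⌋`. [folklore] -/
theorem card_filter_dvd_dvd (X d e : ℕ) :
    ((Icc 1 X).filter fun m => d ∣ m ∧ e ∣ m).card = X / Nat.lcm d e := by
  have h : ((Icc 1 X).filter fun m => d ∣ m ∧ e ∣ m) = (Ioc 0 X).filter fun m => Nat.lcm d e ∣ m := by
    ext m
    simp only [Finset.mem_filter, Finset.mem_Icc, Finset.mem_Ioc, Nat.lcm_dvd_iff]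
    omega
  rw [h, Nat.Ioc_filter_dvd_card_eq_div]

/-- `Σ_{m ≤ X} τ(m)² ≤ X · Σ_{d,e ≤ X} gcd(d,e)/(de)`. [folklore] -/
theorem sum_tau_sq_le_gcd (X : ℕ) :
    ∑ m ∈ Icc 1 X, ((m.divisors.card ^ 2 : ℕ) : ℝ) ≤
      (X : ℝ) * ∑ p ∈ Icc 1 X ×ˢ Icc 1 X, ((Nat.gcd p.1 p.2 : ℕ) : ℝ) / ((p.1 : ℝ) * p.2) := by
  rw [Finset.sum_congr rfl (tau_sq_eq_sum X), Finset.sum_comm, Finset.mul_sum]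
  refine Finset.sum_le_sum fun p hp => ?_
  rw [Finset.mem_product, Finset.mem_Icc, Finset.mem_Icc] at hp
  obtain ⟨⟨hd1, _⟩, ⟨he1, _⟩⟩ := hp
  rw [Finset.sum_boole, card_filter_dvd_dvd]
  have hde : (0 : ℝ) < (p.1 : ℝ) * p.2 := by positivity
  have hlcm : ((Nat.lcm p.1 p.2 : ℕ) : ℝ) * (Nat.gcd p.1 p.2 : ℕ) = (p.1 : ℝ) * p.2 := by
    rw [mul_comm]; exact_mod_cast Nat.gcd_mul_lcm p.1 p.2
  have hlcm0 : 0 < Nat.lcm p.1 p.2 := Nat.lcm_pos hd1 he1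
  have hgcd0 : (0 : ℝ) < (Nat.gcd p.1 p.2 : ℕ) := by exact_mod_cast Nat.gcd_pos_of_pos_left _ hd1
  have hlcm0' : (0 : ℝ) < (Nat.lcm p.1 p.2 : ℕ) := by exact_mod_cast hlcm0
  calc (((X / Nat.lcm p.1 p.2 : ℕ)) : ℝ) ≤ (X : ℝ) / (Nat.lcm p.1 p.2 : ℕ) := Nat.cast_div_le
    _ = X * (((Nat.gcd p.1 p.2 : ℕ) : ℝ) / ((p.1 : ℝ) * p.2)) := by
        rw [← hlcm]
        field_simp

/-- `Σ_{d,e ≤ X} gcd(d,e)/(de) ≤ H_X³`, `H_X = Σ_{k ≤ X} 1/k` (inject `(d,e) ↦ (gcd, d/gcd, e/gcd)`). [folklore] -/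
theorem sum_gcd_le_cube (X : ℕ) :
    ∑ p ∈ Icc 1 X ×ˢ Icc 1 X, ((Nat.gcd p.1 p.2 : ℕ) : ℝ) / ((p.1 : ℝ) * p.2) ≤
      (∑ k ∈ Icc 1 X, (1 : ℝ) / k) ^ 3 := by
  set φ : ℕ × ℕ → ℕ × (ℕ × ℕ) := fun p => (Nat.gcd p.1 p.2, (p.1 / Nat.gcd p.1 p.2, p.2 / Nat.gcd p.1 p.2))
    with hφ
  set G : ℕ × (ℕ × ℕ) → ℝ := fun t => (1 : ℝ) / t.1 * ((1 : ℝ) / t.2.1 * ((1 : ℝ) / t.2.2)) with hG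
  have hinj : Set.InjOn φ ↑(Icc 1 X ×ˢ Icc 1 X) := by
    rintro ⟨d, e⟩ _ ⟨d', e'⟩ _ h
    simp only [hφ, Prod.mk.injEq] at h
    obtain ⟨hg, h1, h2⟩ := h
    have ed : d = Nat.gcd d e * (d / Nat.gcd d e) := (Nat.mul_div_cancel' (Nat.gcd_dvd_left d e)).symm
    have ee : e = Nat.gcd d e * (e / Nat.gcd d e) := (Nat.mul_div_cancel' (Nat.gcd_dvd_right d e)).symm
    have ed' : d' = Nat.gcd d' e' * (d' / Nat.gcd d' e') := (Nat.mul_div_cancel' (Nat.gcd_dvd_left d' e')).symm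
    have ee' : e' = Nat.gcd d' e' * (e' / Nat.gcd d' e') := (Nat.mul_div_cancel' (Nat.gcd_dvd_right d' e')).symm
    rw [Prod.mk.injEq]
    constructor
    · calc d = Nat.gcd d e * (d / Nat.gcd d e) := ed
        _ = Nat.gcd d' e' * (d' / Nat.gcd d' e') := by rw [h1, hg]
        _ = d' := ed'.symm
    · calc e = Nat.gcd d e * (e / Nat.gcd d e) := ee
        _ = Nat.gcd d' e' * (e' / Nat.gcd d' e') := by rw [h2, hg]
        _ = e' := ee'.symm
  have hval : ∀ p ∈ Icc 1 X ×ˢ Icc 1 X, ((Nat.gcd p.1 p.2 : ℕ) : ℝ) / ((p.1 : ℝ) * p.2) = G (φ p) := by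
    rintro ⟨d, e⟩ hp
    rw [Finset.mem_product, Finset.mem_Icc, Finset.mem_Icc] at hp
    obtain ⟨⟨hd1, _⟩, ⟨he1, _⟩⟩ := hp
    have hg0 : 0 < Nat.gcd d e := Nat.gcd_pos_of_pos_left _ hd1
    have ed : ((d / Nat.gcd d e : ℕ) : ℝ) = (d : ℝ) / (Nat.gcd d e : ℕ) :=
      Nat.cast_div (Nat.gcd_dvd_left d e) (by exact_mod_cast hg0.ne')
    have ee : ((e / Nat.gcd d e : ℕ) : ℝ) = (e : ℝ) / (Nat.gcd d e : ℕ) :=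
      Nat.cast_div (Nat.gcd_dvd_right d e) (by exact_mod_cast hg0.ne')
    simp only [hG, hφ, ed, ee]
    have : (0 : ℝ) < (Nat.gcd d e : ℕ) := by exact_mod_cast hg0
    have hd0 : (0 : ℝ) < d := by exact_mod_cast hd1
    have he0 : (0 : ℝ) < e := by exact_mod_cast he1
    field_simp
  have hmaps : ∀ p ∈ Icc 1 X ×ˢ Icc 1 X, φ p ∈ Icc 1 X ×ˢ (Icc 1 X ×ˢ Icc 1 X) := by
    rintro ⟨d, e⟩ hp
    rw [Finset.mem_product, Finset.mem_Icc, Finset.mem_Icc] at hp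
    obtain ⟨⟨hd1, hdX⟩, ⟨he1, heX⟩⟩ := hp
    have hg0 : 0 < Nat.gcd d e := Nat.gcd_pos_of_pos_left _ hd1
    simp only [hφ, Finset.mem_product, Finset.mem_Icc]
    refine ⟨⟨hg0, le_trans (Nat.gcd_le_left _ hd1) hdX⟩, ⟨?_, le_trans (Nat.div_le_self _ _) hdX⟩,
      ⟨?_, le_trans (Nat.div_le_self _ _) heX⟩⟩
    · exact Nat.div_pos (Nat.gcd_le_left _ hd1) hg0
    · exact Nat.div_pos (Nat.gcd_le_right _ he1) hg0
  have hGnn : ∀ t ∈ Icc 1 X ×ˢ (Icc 1 X ×ˢ Icc 1 X), 0 ≤ G t := fun t _ => by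
    simp only [hG]; positivity
  calc ∑ p ∈ Icc 1 X ×ˢ Icc 1 X, ((Nat.gcd p.1 p.2 : ℕ) : ℝ) / ((p.1 : ℝ) * p.2)
      = ∑ p ∈ Icc 1 X ×ˢ Icc 1 X, G (φ p) := Finset.sum_congr rfl hval
    _ = ∑ t ∈ (Icc 1 X ×ˢ Icc 1 X).image φ, G t := (Finset.sum_image hinj).symm
    _ ≤ ∑ t ∈ Icc 1 X ×ˢ (Icc 1 X ×ˢ Icc 1 X), G t :=
        Finset.sum_le_sum_of_subset_of_nonneg (Finset.image_subset_iff.2 hmaps) fun t ht _ => hGnn t ht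
    _ = (∑ k ∈ Icc 1 X, (1 : ℝ) / k) ^ 3 := by
        rw [pow_three, Finset.sum_mul_sum, Finset.sum_mul_sum, Finset.sum_product]
        refine Finset.sum_congr rfl fun g _ => ?_
        rw [Finset.sum_product]
        refine Finset.sum_congr rfl fun a _ => ?_
        rw [Finset.mul_sum]

/-- **`Σ_{m ≤ X} τ(m)² ≤ X · H_X³`.** [Montgomery–Vaughan 2007, §2.3] [folklore] -/
theorem sum_tau_sq_le (X : ℕ) :
    ∑ m ∈ Icc 1 X, ((m.divisors.card ^ 2 : ℕ) : ℝ) ≤ (X : ℝ) * (∑ k ∈ Icc 1 X, (1 : ℝ) / k) ^ 3 :=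
  (sum_tau_sq_le_gcd X).trans (mul_le_mul_of_nonneg_left (sum_gcd_le_cube X) (Nat.cast_nonneg X))

/-! ### Differences of squares: `#{(a, c) : c < a, a² − c² = m} ≤ τ(m)` -/

/-- `#{(a,c) : c < a < X, a² − c² = m} ≤ τ(m)` for `m ≠ 0` (`(a, c) ↦ a − c` is injective into the divisors of
`m = (a − c)(a + c)`). [folklore] -/
theorem card_diffSq_le (X m : ℕ) (hm : m ≠ 0) :
    ((Finset.range X ×ˢ Finset.range X).filter
        (fun ac : ℕ × ℕ => ac.2 < ac.1 ∧ ac.1 ^ 2 - ac.2 ^ 2 = m)).card ≤ m.divisors.card := by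
  refine Finset.card_le_card_of_injOn (fun ac => ac.1 - ac.2) (fun ac hac => ?_) ?_
  · rw [Finset.mem_coe, Finset.mem_filter] at hac
    obtain ⟨_, hlt, hsq⟩ := hac
    rw [Finset.mem_coe, Nat.mem_divisors]
    refine ⟨Dvd.intro_left (ac.1 + ac.2) ?_, hm⟩
    rw [← hsq, Nat.sq_sub_sq]
  · rintro ⟨a, c⟩ hac ⟨a', c'⟩ hac' h
    rw [Finset.mem_coe, Finset.mem_filter] at hac hac'
    obtain ⟨_, hlt, hsq⟩ := hac
    obtain ⟨_, hlt', hsq'⟩ := hac'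
    simp only at h hlt hsq hlt' hsq'
    have h1 : (a + c) * (a - c) = m := by rw [← hsq, Nat.sq_sub_sq]
    have h2 : (a' + c') * (a' - c') = m := by rw [← hsq', Nat.sq_sub_sq]
    have hs : 0 < a - c := by omega
    have hsum : a + c = a' + c' := by
      rw [← h] at h2
      exact Nat.eq_of_mul_eq_mul_right hs (h1.trans h2.symm)
    have ha : a = a' := by omega
    have hc : c = c' := by omega
    rw [ha, hc]

end Summit.QuantumAdvantage.QuantumAdvantage.Theorems.TwoSquaresFloor
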